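import Mathlib
import Summits.Ventures.PercRepro2.Defs
import Summits.Ventures.PercRepro2.Graph
import Summits.Ventures.PercRepro2.OneColourSwitch
import Summits.Ventures.PercRepro2.RegionHubSign
import Summits.Ventures.PercRepro2.SideSwitch
import Summits.Ventures.PercRepro2.SideSwitchFibre
import Summits.Ventures.PercRepro2.SideSwitchClosed
import Summits.Ventures.PercRepro2.SideSwitchComps
import Summits.Ventures.PercRepro2.SideSwitchCompsFibre
import Summits.Ventures.PercRepro2.M9NoPocketDefs
import Summits.Ventures.PercRepro2.M9NoPocketWorld
import Summits.Ventures.PercRepro2.M9NoPocketWorldD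
import Summits.Ventures.PercRepro2.M9NoPocketCompl
import Summits.Ventures.PercRepro2.M9NoPocketM9
import Summits.Ventures.PercRepro2.M9DAvoid
import Summits.Ventures.PercRepro2.M9DAvoidSplit
import Summits.Ventures.PercRepro2.M9RegionSplit
import Summits.Ventures.PercRepro2.M9HarrisCube
import Summits.Ventures.PercRepro2.M9PocketCubeDefs
import Summits.Ventures.PercRepro2.M9PocketCubeFibre
import Summits.Ventures.PercRepro2.M9PocketCubeMono
import Summits.Ventures.PercRepro2.M9PocketCubeHub
import Summits.Ventures.PercRepro2.M9PocketCubeWorldMono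
import Summits.Ventures.PercRepro2.M9PocketCubeCompl

/-!
# The `Y`-hub region is non-negative: Harris on the block-group cube (blind cell PercRepro2,
p3 g23, 2026-08-28; `proofs/P3-HARRIS.md` §5)

On the cube of a pocket representative, the `Y`-hub region `regY` — the legal vectors whose
assignment has a `Y`-hub edge and `r ≁_Y s` — is an **up-set** (`regY_upper`): `hubY` increases,
`r ~_Y s` decreases, and legality propagates upwards because `Sep ∧ hubY` forces `d ∉ K₂` and
no `W`-hub, both of which persist (`sep2_of_not_mem_K2_of_not_hubW`); under the adjacency
hypothesis (i) `DOne` follows from `Sep`.  The tilt lemma of `M9HarrisCube` with the cube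
complement `cdualP` (`σ̃_pq = yInd x − yInd (cdualP x)`) gives `Σ_{regY} σ̃_pq ≥ 0` per
representative (`regY_sum_nonneg`), and the fibration sums it to **`regionY ≥ 0`**
(`regionY_nonneg`).  Own work; std axioms.
-/

namespace Summit.Ventures.PercRepro2

namespace NoPocket

open Finset Classical RegionHub OneColourSwitch SideSwitch

variable {V : Type*} {E : Type*}

section SepTransfer

variable {ends : E → Sym2 V}

/-- A mark `t ≠ d` outside both worlds of `{r, s}` in `G − d` is outside the `Y`-world of `G`
when `d` is, and outside the `W`-world of `G` when there is no `W`-hub edge to `t`. -/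
lemma not_mem_worlds_of_not_mem_K2_of_not_hub {d r s : V} {ω : Config E} {t : V} (htd : t ≠ d)
    (htK : t ∉ K2 (endsD ends d) r s ω) (htM : t ∉ M2 (endsD ends d) r s ω)
    (hK : d ∉ K2 ends r s ω)
    (hW : ¬ ∃ e u, ends e = s(d, u) ∧ OneColourSwitch.compl ω e = true ∧
      Conn (endsD ends d) (OneColourSwitch.compl ω) u t) :
    t ∉ K2 ends r s ω ∧ t ∉ M2 ends r s ω := by
  constructor
  · intro ht
    have hnr : ¬ Conn ends ω r d := fun h => hK (mem_K2_iff.2 (Or.inl h))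
    have hns : ¬ Conn ends ω s d := fun h => hK (mem_K2_iff.2 (Or.inr h))
    rw [mem_K2_iff] at ht
    rcases ht with h | h
    · exact htK (mem_K2_iff.2 (Or.inl (conn_endsD_of_not_conn h hnr)))
    · exact htK (mem_K2_iff.2 (Or.inr (conn_endsD_of_not_conn h hns)))
  · intro ht
    rw [mem_M2_iff] at ht
    rcases ht with h | h
    · by_cases hrd : Conn ends (OneColourSwitch.compl ω) r d
      · obtain ⟨e, u, hends, he, hcu⟩ :=
          conn_d_decomp (ω := OneColourSwitch.compl ω) htd (conn_trans (conn_symm h) hrd)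
        exact hW ⟨e, u, hends, he, conn_symm hcu⟩
      · exact htM (mem_M2_iff.2 (Or.inl (conn_endsD_of_not_conn h hrd)))
    · by_cases hsd : Conn ends (OneColourSwitch.compl ω) s d
      · obtain ⟨e, u, hends, he, hcu⟩ :=
          conn_d_decomp (ω := OneColourSwitch.compl ω) htd (conn_trans (conn_symm h) hsd)
        exact hW ⟨e, u, hends, he, conn_symm hcu⟩
      · exact htM (mem_M2_iff.2 (Or.inr (conn_endsD_of_not_conn h hsd)))

/-- **`Sep` from `Sep` in `G − d`, `d ∉ K₂` and no `W`-hub edge.** -/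
lemma sep2_of_not_mem_K2_of_not_hubW {p q r s d : V} (hpd : p ≠ d) (hqd : q ≠ d) {ω : Config E}
    (hsep : sep2 (endsD ends d) p q r s ω) (hK : d ∉ K2 ends r s ω)
    (hW : ¬ hubW ends d p q ω) : sep2 ends p q r s ω := by
  obtain ⟨hpK, hqK⟩ := not_mem_K2_of_sep2 hsep
  obtain ⟨hpM, hqM⟩ := not_mem_M2_of_sep2 hsep
  have hp := not_mem_worlds_of_not_mem_K2_of_not_hub hpd hpK hpM hK
    (fun ⟨e, u, hends, he, hc⟩ => hW ⟨e, u, hends, he, Or.inl hc⟩)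
  have hq := not_mem_worlds_of_not_mem_K2_of_not_hub hqd hqK hqM hK
    (fun ⟨e, u, hends, he, hc⟩ => hW ⟨e, u, hends, he, Or.inr hc⟩)
  exact sep2_iff.2 ⟨⟨hp.1, hq.1⟩, ⟨hp.2, hq.2⟩⟩

end SepTransfer

section Region

variable [Fintype V] [DecidableEq V] [Fintype E] [DecidableEq E]

variable (ends : E → Sym2 V)

/-- The `Y`-hub region of a representative: the legal vectors with a `Y`-hub edge and
`r ≁_Y s`. -/
noncomputable def regY (p q r s d : V) (ρ : Config E) : Finset (Finset (Finset V) × Finset E) :=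
  (cubeP ends d r s ρ).filter (fun x => assignX ends x ρ ∈ DOneSet ends p q r s d ∧
    hubY ends d p q (assignX ends x ρ) ∧ ¬ Conn ends (assignX ends x ρ) r s)

variable {ends}

/-- Membership in the `Y`-hub region. -/
lemma mem_regY {p q r s d : V} {ρ : Config E} {x : Finset (Finset V) × Finset E} :
    x ∈ regY ends p q r s d ρ ↔ x ∈ cubeP ends d r s ρ ∧
      (assignX ends x ρ ∈ DOneSet ends p q r s d ∧ hubY ends d p q (assignX ends x ρ) ∧
        ¬ Conn ends (assignX ends x ρ) r s) := by
  simp [regY]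

/-- **The `Y`-hub region is an up-set of the cube.** -/
theorem regY_upper {p q r s d : V}
    (hadj : ∀ x, Nonmark p q r s x → x ≠ d → ∃ e, ends e = s(x, p) ∨ ends e = s(x, q))
    (hr : d ≠ r) (hs : d ≠ s) (hpd : p ≠ d) (hqd : q ≠ d) {er : E} (her : ends er = s(d, r))
    {ρ : Config E} (hρ : ρ ∈ RepP ends p q r s d) {x x' : Finset (Finset V) × Finset E}
    (hxx' : x ≤ x') (hx' : x' ∈ cubeP ends d r s ρ) (hx : x ∈ regY ends p q r s d ρ) :
    x' ∈ regY ends p q r s d ρ := by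
  obtain ⟨hρD, _⟩ := mem_RepP.1 hρ
  obtain ⟨hxc, hxD, hY, hrs⟩ := mem_regY.1 hx
  obtain ⟨hsep, _⟩ := mem_DOneSet.1 hxD
  obtain ⟨hT', hF'⟩ := mem_cubeP.1 hx'
  have hY' := hubY_assignX_mono hr hs hpd hqd hρ hxx' hxc hx' hY
  have hrs' : ¬ Conn ends (assignX ends x' ρ) r s :=
    fun h => hrs (conn_rs_assignX_anti' hr hs hρ hxx' hxc hx' h)
  have hK' : d ∉ K2 ends r s (assignX ends x' ρ) :=
    fun h => not_mem_K2_of_hubY hsep hY (mem_K2_assignX_anti hr hs hρ hxx' hxc hx' h)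
  have hW' : ¬ hubW ends d p q (assignX ends x' ρ) := fun h =>
    not_hubY_and_hubW hsep her ⟨hY, hubW_assignX_anti hr hs hpd hqd hρ hxx' hxc hx' h⟩
  have hsep' : sep2 ends p q r s (assignX ends x' ρ) :=
    sep2_of_not_mem_K2_of_not_hubW hpd hqd (sep2_endsD_assignX' hr hs hρD hT' hF') hK' hW'
  exact mem_regY.2 ⟨hx', mem_DOneSet.2 ⟨hsep', DOne_of_adj hadj hsep'⟩, hY', hrs'⟩

/-- The Harris cube of `(blocks, free edges)` is the cube of the representative. -/
lemma cube_eq_cubeP {d r s : V} (ρ : Config E) :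
    HarrisCube.cube (blocks ends d r s ρ, freeE ends d r s ρ) = cubeP ends d r s ρ := by
  ext x
  rw [HarrisCube.mem_cube, mem_cubeP, Prod.le_def]

/-- **Harris for the `Y`-hub region**: `Σ_{regY} σ̃_pq ≥ 0` for every pocket representative. -/
theorem regY_sum_nonneg {p q r s d : V}
    (hadj : ∀ x, Nonmark p q r s x → x ≠ d → ∃ e, ends e = s(x, p) ∨ ends e = s(x, q))
    (hr : d ≠ r) (hs : d ≠ s) (hpd : p ≠ d) (hqd : q ≠ d) {er : E} (her : ends er = s(d, r))
    {ρ : Config E} (hρ : ρ ∈ RepP ends p q r s d) :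
    0 ≤ ∑ x ∈ regY ends p q r s d ρ, sigma (endsD ends d) (assignX ends x ρ) p q := by
  obtain ⟨hρD, _⟩ := mem_RepP.1 hρ
  set c : Finset (Finset V) × Finset E := (blocks ends d r s ρ, freeE ends d r s ρ) with hc
  have hcube : HarrisCube.cube c = cubeP ends d r s ρ := cube_eq_cubeP ρ
  have hle : ∀ x, x ≤ c ↔ x ∈ cubeP ends d r s ρ := fun x => by
    rw [← HarrisCube.mem_cube, hcube]
  -- the tilt lemma with `f = yInd`, `h = 1[regY]`, `κ = cdualP`
  have key := HarrisCube.sum_sub_comp_mul_nonneg c (κ := cdualP ends d r s ρ)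
    (fun x hx => (hle _).2 (cdualP_mem_cubeP ρ x))
    (fun x hx => cdualP_cdualP ((hle x).1 hx))
    (fun x _ y _ hxy => cdualP_antitone ρ hxy)
    (f := yInd ends p q d ρ)
    (h := fun x => if x ∈ regY ends p q r s d ρ then 1 else 0)
    (fun x _ => yInd_nonneg ρ x) (fun x _ => by split_ifs <;> norm_num)
    ?_ ?_
  · rw [hcube] at key
    refine key.trans (le_of_eq ?_)
    rw [regY, Finset.sum_filter]
    refine Finset.sum_congr rfl fun x hx => ?_
    rw [sigma_endsD_eq_sub_cdualP hr hs hρD hx]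
    by_cases hP : (assignX ends x ρ ∈ DOneSet ends p q r s d ∧ hubY ends d p q (assignX ends x ρ) ∧
        ¬ Conn ends (assignX ends x ρ) r s)
    · simp [Finset.mem_filter, hx, hP]
    · simp [Finset.mem_filter, hP]
  · -- `yInd` is monotone on the cube
    intro x hx y hy hxy
    have hx' := (hle x).1 hx
    have hy' := (hle y).1 hy
    obtain ⟨hT, hF⟩ := mem_cubeP.1 hx'
    simp only [yInd]
    split_ifs with h1 h2
    · exact le_rfl
    · exfalso
      apply h2
      exact conn_endsD_assignX_mono hr hs hρ hxy hx' hy'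
        (not_mem_K2_of_sep2 (sep2_endsD_assignX' hr hs hρD hT hF)).1 h1
    · norm_num
    · exact le_rfl
  · -- the indicator of the region is monotone on the cube
    intro x hx y hy hxy
    dsimp only
    split_ifs with h1 h2
    · exact le_rfl
    · exact (h2 (regY_upper hadj hr hs hpd hqd her hρ hxy ((hle y).1 hy) h1)).elim
    · norm_num
    · exact le_rfl

/-- **`regionY ≥ 0`** under the adjacency hypothesis (i) and the edges `d–r`, `d–s`. -/
theorem regionY_nonneg {p q r s d : V}
    (hadj : ∀ x, Nonmark p q r s x → x ≠ d → ∃ e, ends e = s(x, p) ∨ ends e = s(x, q))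
    (hr : d ≠ r) (hs : d ≠ s) (hpd : p ≠ d) (hqd : q ≠ d) {er : E} (her : ends er = s(d, r)) :
    0 ≤ regionY ends p q r s d := by
  have h1 : regionY ends p q r s d = ∑ ω ∈ DOneSet ends p q r s d,
      (if hubY ends d p q ω ∧ ¬ Conn ends ω r s then sigma (endsD ends d) ω p q else 0) := by
    unfold regionY DOneSet
    rw [Finset.sum_filter]
    refine Finset.sum_congr rfl fun ω _ => ?_
    by_cases h : sep2 ends p q r s ω ∧ DOne ends r s d ω
    · simp [h]
    · simp only [h, if_false]
      have : ¬ (sep2 ends p q r s ω ∧ DOne ends r s d ω ∧ hubY ends d p q ω ∧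
          ¬ Conn ends ω r s) := fun h' => h ⟨h'.1, h'.2.1⟩
      simp [this]
  rw [h1, sum_dOne_eq_sum_repP_legalP hr hs]
  refine Finset.sum_nonneg fun ρ hρ => ?_
  have h2 : ∑ x ∈ LegalP ends p q r s d ρ,
      (if hubY ends d p q (assignX ends x ρ) ∧ ¬ Conn ends (assignX ends x ρ) r s then
        sigma (endsD ends d) (assignX ends x ρ) p q else 0) =
      ∑ x ∈ regY ends p q r s d ρ, sigma (endsD ends d) (assignX ends x ρ) p q := by
    rw [← Finset.sum_filter]
    refine Finset.sum_congr ?_ fun _ _ => rfl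
    ext x
    simp only [Finset.mem_filter, mem_LegalP, mem_regY]
    tauto
  rw [h2]
  exact regY_sum_nonneg hadj hr hs hpd hqd her hρ

end Region

end NoPocket

end Summit.Ventures.PercRepro2
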